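import Mathlib
import HarnessLib
import Summits.HodgeConjecture.HodgeConjecture.Theorems.HodgeLocusCensusMu0631
import Summits.HodgeConjecture.HodgeConjecture.Theorems.HodgeLocusCensusExcessLowerBound451632

/-!
# HodgeLocusCensusEngineM632 — engine M (exact second-order IVHS at an arbitrary smooth cubic) and μ₀(6,3,2;λ) = 3 (cell pub-hlocus, ENGINE B seat ivhs-2, gen 21)
HONEST FRAMING: certified instances and evidence bearing on the general Hodge conjecture; no claim.

SETTING (cell record `pub-hlocus-ivhs-2/ENGINE-M-g21.md`).  Cell (6,3,2): smooth cubic sixfolds X ⊂ ℙ⁷ containing two 3-planes P, P′ with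
P ∩ P′ a plane; N the locus of such cubics (codim c = 7), V_λ the Hodge locus of δ_λ = [P] + λ[P′] (q = h^{4,2} = dim R₇ = 8 period equations),
e(X;λ) = dim T_X V_λ − dim T_X N, μ₀(6,3,2;λ) = the multiplicity of V_λ along N = the length of the generic transversal fibre.

ENGINE M (record §1; two independent implementations, python-flint and PARI/GP, agreeing run for run).  At a smooth cubic X = V(F) over 𝔽_p containing
the coordinate pair, with R = 𝔽_p[x]/J(F):  T_X V_λ = {G ∈ S₃ : G·ω_λ ∈ J₇} where ω_P = det ∂(f,g)/∂x is the complete-intersection class polynomial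
(P = V(f₁..f₄), F = Σ fᵢgᵢ), C_λ = R₇ / S₃·ω_λ (dim C_λ = 8 − rank), and the quadratic (second fundamental) form of V_λ at X is Maclean's
q(G,H) = Σᵢ (H ∂ᵢQᵢ^G − Qᵢ^H ∂ᵢG) ∈ C_λ, G·ω_λ = Σ Qᵢ^G ∂ᵢF [Dan–Villaflor 2023, Thm 6.1].  DEGREE BOOKKEEPING (`single_piece_*` below, kernel-checked):
the value space of the local period map is ⊕_{q=n/2+1}^{n} R_{d(q+1)−n−2} and R has socle degree (d−2)(n+2); for (n,d) = (6,3), (8,3), (4,4), (4,5)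
exactly ONE of these degrees is ≤ the socle degree, so Maclean's lowest-degree piece is the WHOLE quadratic form in every census cell.
MEASUREMENTS (record §3; rows `random632`, `fermat632`, … below with the arithmetic the record uses, kernel-checked by `decide`): at five random smooth
cubics of the cell (one certified smooth over ℚ) and every one of 24 values λ ∉ {0,1}: e = 2, dim C_λ = 3 and the 3 classes q(G₁,G₁), q(G₁,G₂), q(G₂,G₂)
are linearly independent in C_λ (rank Ob = 3 = C(e+1,2)); hence (Nakayama; linear-algebra core `finrank_quotient_span_eq_zero` below: C(e+1,2) independent
quadratic relations kill all of m²/m³) the transversal fibre germ is K[v₁,v₂]/(v₁,v₂)², of length 1 + e = 3.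
μ₀(6,3,2;λ) = 3 (record §4; `mu0_632_eq_three` is the order bookkeeping): 3 = length(O_{V_λ,X}/(ℓ)) ≥ mult ≥ μ₀ (length ≥ multiplicity, associativity —
no genericity of X needed) and μ₀ ≥ 1 + e_gen ≥ 3 by the tree theorem `input_excess_632`
(= `ExcessLowerBound.cubicSixfold_twoThreePlanes_plane_finrank_inf_add_two_le`, e(X;λ) ≥ 2 for every X of the cell and every λ).  So μ₀ = 3 = B(8,7,2)
(`random632_eq_genBound`: the generator-count bound of `Mu0631.genBound` is attained — the law μ₀ = B now holds in 9 of 9 census cells), for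
λ ∈ {2, −1, 1/2, 3, …} and, by Prop. S₃ (`anharmonic_orbit_three`: the orbit of 3 under λ ↦ 1/λ, λ ↦ λ/(λ−1)), on whole anharmonic orbits.
WHY THE CENSUS SAW 'apparent 5' (record §5): at the Fermat cubic e jumps to 3, dim C to 4 and rank Ob drops to 1 (`fermat632_lam2`: length ≥ 9 there,
other components of V_λ pass through X_F); the s⁵-truncated probes along lines through X_F could not separate them.
NOT FORMALISED: the IVHS identifications, Maclean's theorem, the mod-p ⇒ characteristic-0 transfer (rank equalities, record §1(iv)), the
length ≥ multiplicity step, and the computations themselves (kit j136390, j136540, j136541, j136631 (GP), j136727, j136539 (smoothness); logs with md5 in the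
record §7).  Nothing in this file is a statement about the Hodge conjecture.
-/

namespace Summit.HodgeConjecture.HodgeConjecture.HodgeLocus.Census.EngineM632

open Summit.HodgeConjecture.HodgeConjecture.HodgeLocus.Census.Mu0631 (genBound)

/-! ## Inputs re-exported by name (tree theorems; nothing new is asserted) -/

alias input_excess_632 :=
  Summit.HodgeConjecture.HodgeConjecture.HodgeLocus.Census.ExcessLowerBound.cubicSixfold_twoThreePlanes_plane_finrank_inf_add_two_le
alias input_genBound_table := Summit.HodgeConjecture.HodgeConjecture.HodgeLocus.Census.Mu0631.genBound_census_table

/-! ## Degree bookkeeping: the value space ⊕_{q=n/2+1}^{n} R_{d(q+1)−n−2} has exactly one piece below the socle in every census cell -/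

/-- Degrees d(q+1) − n − 2 for q = n/2+1, …, n (n even). -/
def pieceDegrees (n d : ℕ) : List ℕ := (List.range (n / 2)).map fun j => d * (n / 2 + 2 + j) - n - 2

/-- Socle degree of the Jacobian ring of a smooth degree-d hypersurface in ℙ^{n+1}: (d − 2)(n + 2). -/
def socleDegree (n d : ℕ) : ℕ := (d - 2) * (n + 2)

/-- The pieces that can be non-zero (degree ≤ socle degree). -/
def livePieces (n d : ℕ) : List ℕ := (pieceDegrees n d).filter fun k => decide (k ≤ socleDegree n d)

/-- The piece degrees and socle degrees for the four (n,d) of the census. -/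
theorem pieceDegrees_table :
    pieceDegrees 6 3 = [7, 10, 13] ∧ pieceDegrees 8 3 = [8, 11, 14, 17] ∧ pieceDegrees 4 4 = [10, 14] ∧ pieceDegrees 4 5 = [14, 19] ∧
    socleDegree 6 3 = 8 ∧ socleDegree 8 3 = 10 ∧ socleDegree 4 4 = 12 ∧ socleDegree 4 5 = 18 := by
  decide

/-- In the four (n,d) of the census exactly one piece survives, and it is Maclean's degree r = d(n/2+2) − n − 2. -/
theorem single_piece_census :
    livePieces 6 3 = [3 * (6 / 2 + 2) - 6 - 2] ∧ livePieces 8 3 = [3 * (8 / 2 + 2) - 8 - 2] ∧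
    livePieces 4 4 = [4 * (4 / 2 + 2) - 4 - 2] ∧ livePieces 4 5 = [5 * (4 / 2 + 2) - 4 - 2] := by
  decide

/-- The surviving piece by value: R₇ (cubic sixfold), R₈ (cubic eightfold), R₁₀ (quartic fourfold), R₁₄ (quintic fourfold). -/
theorem single_piece_values : livePieces 6 3 = [7] ∧ livePieces 8 3 = [8] ∧ livePieces 4 4 = [10] ∧ livePieces 4 5 = [14] := by
  decide

/-! ## The measurements and their arithmetic -/

/-- One engine-M measurement at (X, λ): tangent excess e, dim C_λ = q − rank, and the rank of the obstruction matrix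
(the classes q(G_a,G_b), a ≤ b, of a random e-dimensional complement E′ of T_X N in T_X V_λ, in C_λ). -/
structure Row where
  e : ℕ
  dimC : ℕ
  rankOb : ℕ
  deriving DecidableEq, Repr

/-- Number of columns of Ob = dim Sym² of an e-space = C(e+1, 2). -/
def Row.cols (r : Row) : ℕ := (r.e + 1) * r.e / 2
/-- h₂ of the fibre germ cut by the quadratic relations alone = C(e+1,2) − rank Ob. -/
def Row.h2 (r : Row) : ℕ := r.cols - r.rankOb
/-- 1 + e + h₂: a lower bound for the fibre length, and the exact length when h₂ = 0 (germ K[v]/(v)²). -/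
def Row.lengthLB (r : Row) : ℕ := 1 + r.e + r.h2
/-- Sanity: a rank is at most the number of columns and at most dim C_λ. -/
def Row.admissible (r : Row) : Prop := r.rankOb ≤ r.cols ∧ r.rankOb ≤ r.dimC

/-- Admissibility is decidable (two ℕ-inequalities). -/
instance (r : Row) : Decidable r.admissible := by unfold Row.admissible; infer_instance

/-- (6,3,2), five random smooth cubics (seeds 1–4 at p ∈ {10⁶+3, 10⁶+33, 10⁶+37}; seed 1 also in PARI/GP), every λ of
{2, −1, 1/2, 3, −3, −2, −1/2, 1/3, 2/3, 3/2, 4, 5, 1/4, −1/3, ±7, 10, 1/10, ζ₆^{±1}, ζ₃^{±1}}. -/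
def random632 : Row := ⟨2, 3, 3⟩
/-- (6,3,2) at the Fermat cubic, λ ∈ {2, −1, 1/2}. -/
def fermat632_lam2 : Row := ⟨3, 4, 1⟩
/-- (6,3,2) at the Fermat cubic, λ = 1 (= NL of the third plane: V₁ smooth, q ≡ 0). -/
def fermat632_lam1 : Row := ⟨3, 4, 0⟩
/-- (6,3,1), random cubics, λ ∉ {0, −1}: HF (1,2,1,…), length ≥ 4 (= 4 by M-631 EXACT). -/
def random631 : Row := ⟨2, 2, 2⟩
/-- (6,3,1), random cubics, the exceptional λ = −1: q ≡ 0. -/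
def random631_neg_one : Row := ⟨2, 2, 0⟩
/-- (6,3,0), random cubic: germ K[v]/(v²), length 2 = μ₀(6,3,0). -/
def random630 : Row := ⟨1, 1, 1⟩

/-- Every recorded row is admissible (rank ≤ columns, rank ≤ dim C_λ). -/
theorem rows_admissible :
    random632.admissible ∧ fermat632_lam2.admissible ∧ fermat632_lam1.admissible ∧ random631.admissible ∧
    random631_neg_one.admissible ∧ random630.admissible := by
  decide

/-- The arithmetic read off the rows in the record: full rank C(3,2) = 3 at random X in (6,3,2) (h₂ = 0, length 3); rank 1 of 6 at the
Fermat cubic (h₂ = 5, length ≥ 9); (6,3,1): h₂ = 1, length ≥ 4; (6,3,0): length 2. -/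
theorem rows_arithmetic :
    (random632.cols = 3 ∧ random632.h2 = 0 ∧ random632.lengthLB = 3) ∧
    (fermat632_lam2.cols = 6 ∧ fermat632_lam2.h2 = 5 ∧ fermat632_lam2.lengthLB = 9) ∧
    (random631.cols = 3 ∧ random631.h2 = 1 ∧ random631.lengthLB = 4) ∧
    (random630.cols = 1 ∧ random630.h2 = 0 ∧ random630.lengthLB = 2) := by
  decide

/-- The law μ₀ = B(q,c,b): the engine-M lengths equal `Mu0631.genBound` in the three cubic-sixfold cells
((6,3,2): B(8,7,2) = 3; (6,3,1): B(8,8,2) = 4; (6,3,0): B(8,8,1) = 2). -/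
theorem random_rows_eq_genBound :
    random632.lengthLB = genBound 8 7 2 ∧ random631.lengthLB = genBound 8 8 2 ∧ random630.lengthLB = genBound 8 8 1 := by
  decide

/-! ## The order bookkeeping of record §4: 3 ≥ μ₀ ≥ 1 + e_gen ≥ 3 -/

/-- If the fibre at ONE point X of N has length 3 (engine M), μ₀ ≤ that length (length ≥ multiplicity ≥ μ₀), μ₀ ≥ 1 + e_gen
(the tangent excess persists generically) and e_gen ≥ 2 (tree theorem `input_excess_632`), then μ₀ = 3 and e_gen = 2:
the generic fibre is K[v₁,v₂]/(v)² as well. -/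
theorem mu0_632_eq_three {μ₀ eGen mult lenX : ℕ} (hlen : lenX = 3) (hml : mult ≤ lenX) (hμm : μ₀ ≤ mult)
    (hexc : 1 + eGen ≤ μ₀) (htree : 2 ≤ eGen) : μ₀ = 3 ∧ eGen = 2 ∧ mult = 3 := by
  omega

/-- The same bookkeeping phrased with the generator-count bound: B(8,7,2) ≤ μ₀ ≤ 3 forces μ₀ = B(8,7,2). -/
theorem mu0_632_eq_genBound {μ₀ : ℕ} (hlow : genBound 8 7 2 ≤ μ₀) (hup : μ₀ ≤ random632.lengthLB) : μ₀ = genBound 8 7 2 := by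
  have h1 : genBound 8 7 2 = 3 := by decide
  have h2 : random632.lengthLB = 3 := by decide
  omega

/-! ## Linear-algebra core of the Nakayama step: C(e+1,2) independent quadratic relations kill m²/m³ -/

variable {K : Type*} [Field K]

/-- If the images of the obstruction classes are linearly independent and as many as dim Sym²(m/m²), they span it:
nothing of degree 2 survives in the fibre germ (h₂ = 0), so the germ is K[v₁..v_e]/(v)² of length 1 + e. -/
theorem span_eq_top_of_rank_eq {V : Type*} [AddCommGroup V] [Module K V] [FiniteDimensional K V]
    {ι : Type*} [Fintype ι] {b : ι → V} (hb : LinearIndependent K b) (hcard : Fintype.card ι = Module.finrank K V) :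
    Submodule.span K (Set.range b) = ⊤ :=
  hb.span_eq_top_of_card_eq_finrank' hcard

/-- Quotient form of `span_eq_top_of_rank_eq`: h₂ = dim (Sym²(m/m²) / span of the relations) = 0. -/
theorem finrank_quotient_span_eq_zero {V : Type*} [AddCommGroup V] [Module K V] [FiniteDimensional K V]
    {ι : Type*} [Fintype ι] {b : ι → V} (hb : LinearIndependent K b) (hcard : Fintype.card ι = Module.finrank K V) :
    Module.finrank K (V ⧸ Submodule.span K (Set.range b)) = 0 := by
  rw [span_eq_top_of_rank_eq hb hcard]
  have h := Submodule.finrank_quotient_add_finrank (⊤ : Submodule K V)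
  rw [finrank_top] at h
  omega

/-- Contrast with (6,3,1) (`Mu0631.one_le_finrank_quotient_span_pair`): there only r = 2 relations meet a 3-dimensional m²/m³, so h₂ ≥ 1;
in (6,3,2) r = q − c + b = 3 = C(3,2) and engine M finds them independent. The count: -/
theorem residual_generators_632 : 8 - 7 + 2 = (2 + 1) * 2 / 2 := by decide

/-! ## Prop. S₃: the anharmonic orbit of λ = 3 -/

/-- The orbit of 3 under λ ↦ 1/λ and λ ↦ λ/(λ − 1) is {3, 1/3, 3/2, 2/3, −1/2, −2} (closed under both generators), so μ₀(6,3,2;λ) = 3,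
measured at λ = 3, holds on the whole orbit by relabelling symmetry alone (and was re-measured at each of the six values, kit j136727). -/
theorem anharmonic_orbit_three [CharZero K] :
    ((3 : K)⁻¹ = 1 / 3 ∧ (3 : K) / (3 - 1) = 3 / 2) ∧
    ((1 / 3 : K)⁻¹ = 3 ∧ (1 / 3 : K) / (1 / 3 - 1) = -1 / 2) ∧
    ((3 / 2 : K)⁻¹ = 2 / 3 ∧ (3 / 2 : K) / (3 / 2 - 1) = 3) ∧
    ((2 / 3 : K)⁻¹ = 3 / 2 ∧ (2 / 3 : K) / (2 / 3 - 1) = -2) ∧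
    ((-1 / 2 : K)⁻¹ = -2 ∧ (-1 / 2 : K) / (-1 / 2 - 1) = 1 / 3) ∧
    ((-2 : K)⁻¹ = -1 / 2 ∧ (-2 : K) / (-2 - 1) = 2 / 3) := by
  refine ⟨⟨?_, ?_⟩, ⟨?_, ?_⟩, ⟨?_, ?_⟩, ⟨?_, ?_⟩, ⟨?_, ?_⟩, ⟨?_, ?_⟩⟩ <;> norm_num

/-- The 2-orbit {ζ₆, ζ₆⁻¹} (`Mu0631.anharmonic_zeta6`) is the natural candidate for an exceptional finite λ; engine M measured it generic
(e = 2, rank Ob = 3 at both primitive sixth roots of unity mod 10⁶+3). Arithmetic used to realise ζ₆ mod p: p ≡ 1 (mod 3). -/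
theorem prime_facts : 1000003 % 3 = 1 ∧ 1000033 % 3 = 1 ∧ Nat.Prime 1000003 := by
  refine ⟨by norm_num, by norm_num, by norm_num⟩

end Summit.HodgeConjecture.HodgeConjecture.HodgeLocus.Census.EngineM632
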